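import Summits.CriticalPhenomena.PercolationContinuityZ3.Theorems.PercNearOneGluingNoHeavyPcintChordRandBooking
import Summits.CriticalPhenomena.PercolationContinuityZ3.Theorems.PercNearOneGluingNoHeavyPcintMemAutomaton
import HarnessLib

/-!
# PCINT lane, kind `chordrand_cw` on DANGEROUS-SET states: the booking inequality for remembered visibility

Cell `prim-pcint` (PAPER-2 track (iii): certified intervals for `p_c(ℤ^d)`), seat `prim-pcint-2` (gen 4); support file
(`--supports stmt-CriticalPhenomena-4575`).  Does NOT build on p205010.  Memo: `run/shared/lean/prim/pcint/REDUCTIONS.md`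
§B3r.1 (R), §B3r.2 (β'), §B3r.6; this is the twin of `…PcintChordRandBooking` (window automata) for the memory-`τ`
dangerous-set automaton of `…PcintMemAutomaton` (`mstep τ`, `danger τ`), whose notion of "visible" is
`IsRem τ γ i t` : `1 ≤ t - i ≤ τ - 1` and `‖v_i - v_t‖₁ ≤ τ - (t - i)` (the site `v_i` is in the dangerous set at time `t`).

Reading letter `t` (new vertex `v_{t+1}`) the B3r rule charges every lattice neighbour `w` of `v_{t+1}` that is neither
the current endpoint `v_t` nor a remembered site and has a remembered incidence `v_i ~ w`.  If `w = v_h` is a path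
vertex (`h > t + 1` a FUTURE vertex, or `h < t` a FORGOTTEN one) this is an "on-path event" `(t, h)` (`onEventsR`).  We
book `(t, h)` with `h < t` on the chord `(h, t+1)` — NOT detected at time `t` since `v_h` is not remembered — and
`(t, h)` with `h > t + 1` on the chord `(x, h)`, `x` the incidence of `v_h` immediately preceding `t + 1`
(`prevInc`, from `…PcintChordRandBooking`).  Each DETECTED chord (`visChordsR`: lower endpoint remembered one step
before the upper endpoint is created) receives at most one event, each undetected chord (`invChordsR`) at most two:
`card_onEventsR_le`.  Also `sum_remChordTrue_eq`: the per-time remembered chord counts add up to `#visChordsR`.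
No parity or span arithmetic is needed: visibility is carried semantically by `IsRem`.
-/

noncomputable section

namespace Summit.CriticalPhenomena.PercolationContinuityZ3.Theorems.Pcint

open Finset Literature.Probability.Percolation Literature.Probability.LatticeModels

variable {d n : ℕ}

/-! ### Remembered sites, on-path events, detected and undetected chords -/

/-- `v_i` is REMEMBERED at time `t` by the memory-`τ` dangerous-set automaton: `1 ≤ t - i ≤ τ - 1` and
`‖v_i - v_t‖₁ ≤ τ - (t - i)`, i.e. `(v_i - v_t, t - i) ∈ danger τ (v_0 … v_t)`. [folklore] -/
def IsRem (τ : ℕ) (γ : Fin n → Fin d × Bool) (i t : ℕ) : Prop :=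
  i + 1 ≤ t ∧ t ≤ i + (τ - 1) ∧ l1 (wordPos γ i - wordPos γ t) ≤ τ - (t - i)

open Classical in
/-- The ON-PATH EVENTS `(t, h)` of the dangerous-set B3r automaton along a word of length `n`: `v_h` (`h ≤ n`,
`h ∉ {t, t+1}`) is NOT remembered at time `t`, is adjacent to the new vertex `v_{t+1}`, and is adjacent to some
remembered `v_i`. [folklore] -/
def onEventsR (τ : ℕ) (γ : Fin n → Fin d × Bool) : Finset (ℕ × ℕ) :=
  (range n ×ˢ range (n + 1)).filter fun th =>
    th.2 ≠ th.1 ∧ th.2 ≠ th.1 + 1 ∧ ¬ IsRem τ γ th.2 th.1 ∧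
      (zdGraph d).Adj (wordPos γ th.2) (wordPos γ (th.1 + 1)) ∧
        ∃ i < th.1, IsRem τ γ i th.1 ∧ (zdGraph d).Adj (wordPos γ i) (wordPos γ th.2)

/-- Membership in `onEventsR`. [folklore] -/
theorem mem_onEventsR {τ : ℕ} {γ : Fin n → Fin d × Bool} {th : ℕ × ℕ} :
    th ∈ onEventsR τ γ ↔ th.1 < n ∧ th.2 ≤ n ∧ th.2 ≠ th.1 ∧ th.2 ≠ th.1 + 1 ∧ ¬ IsRem τ γ th.2 th.1 ∧
      (zdGraph d).Adj (wordPos γ th.2) (wordPos γ (th.1 + 1)) ∧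
        ∃ i, i < th.1 ∧ IsRem τ γ i th.1 ∧ (zdGraph d).Adj (wordPos γ i) (wordPos γ th.2) := by
  classical
  rw [onEventsR, mem_filter, mem_product, mem_range, mem_range, Nat.lt_succ_iff]
  constructor
  · rintro ⟨⟨h1, h2⟩, h3, h4, h5, h6, i, hi, h7, h8⟩
    exact ⟨h1, h2, h3, h4, h5, h6, i, hi, h7, h8⟩
  · rintro ⟨h1, h2, h3, h4, h5, h6, i, hi, h7, h8⟩
    exact ⟨⟨h1, h2⟩, h3, h4, h5, h6, i, hi, h7, h8⟩

open Classical in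
/-- The DETECTED chords for memory `τ`: chord pairs `(i, j)` whose lower endpoint is remembered at time `j - 1`.
[folklore] -/
def visChordsR (τ : ℕ) (γ : Fin n → Fin d × Bool) : Finset (ℕ × ℕ) :=
  (chordPairs γ).filter fun ij => IsRem τ γ ij.1 (ij.2 - 1)

open Classical in
/-- The UNDETECTED chords for memory `τ`. [folklore] -/
def invChordsR (τ : ℕ) (γ : Fin n → Fin d × Bool) : Finset (ℕ × ℕ) :=
  (chordPairs γ).filter fun ij => ¬ IsRem τ γ ij.1 (ij.2 - 1)

/-- Detected and undetected chords partition the chord pairs. [folklore] -/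
theorem card_visChordsR_add_card_invChordsR (τ : ℕ) (γ : Fin n → Fin d × Bool) :
    (visChordsR τ γ).card + (invChordsR τ γ).card = (chordPairs γ).card := by
  classical
  unfold visChordsR invChordsR
  exact card_filter_add_card_filter_not _

/-- Detected and undetected chords are disjoint. [folklore] -/
theorem disjoint_visChordsR_invChordsR (τ : ℕ) (γ : Fin n → Fin d × Bool) :
    Disjoint (visChordsR τ γ) (invChordsR τ γ) := by
  classical
  rw [disjoint_left]
  intro ij h1 h2
  exact (mem_filter.1 h2).2 (mem_filter.1 h1).2

/-! ### The booking map -/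

/-- The booking map: an event at a forgotten vertex `h < t` goes to the long chord `(h, t+1)`, an event at a future
vertex `h > t + 1` to the chord from its incidence immediately preceding `t + 1`. [folklore] -/
def bookR (γ : Fin n → Fin d × Bool) (th : ℕ × ℕ) : ℕ × ℕ :=
  if th.2 < th.1 then (th.2, th.1 + 1) else (prevInc γ (th.1 + 1) th.2, th.2)

/-- The booking map lands in the chord pairs; events at forgotten vertices land in the undetected chords. [folklore] -/
theorem bookR_mem {τ : ℕ} {γ : Fin n → Fin d × Bool} {th : ℕ × ℕ} (h : th ∈ onEventsR τ γ) :
    bookR γ th ∈ visChordsR τ γ ∪ invChordsR τ γ ∧ (th.2 < th.1 → bookR γ th ∈ invChordsR τ γ) := by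
  classical
  obtain ⟨htn, hhn, hne, hne1, hnr, hadjT, i, hit, hir, hadji⟩ := mem_onEventsR.1 h
  by_cases hlt : th.2 < th.1
  · have hmem : bookR γ th ∈ invChordsR τ γ := by
      rw [bookR, if_pos hlt, invChordsR, mem_filter, mem_chordPairs]
      refine ⟨⟨by simp only; omega, by simp only; omega, hadjT⟩, ?_⟩
      simp only [Nat.add_sub_cancel]
      exact hnr
    exact ⟨mem_union_right _ hmem, fun _ => hmem⟩
  · have hgt : th.1 + 1 < th.2 := by omega
    have hi1 : i + 1 ≤ th.1 := hir.1
    obtain ⟨-, hpT, hp2, hpadj⟩ := prevInc_spec γ (T := th.1 + 1) (h := th.2) (i := i) (by omega) (by omega) hadji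
    refine ⟨?_, fun h' => (hlt h').elim⟩
    rw [bookR, if_neg hlt]
    have hcp : (prevInc γ (th.1 + 1) th.2, th.2) ∈ chordPairs γ := mem_chordPairs.2 ⟨hp2, hhn, hpadj⟩
    by_cases hvis : IsRem τ γ (prevInc γ (th.1 + 1) th.2) (th.2 - 1)
    · exact mem_union_left _ (mem_filter.2 ⟨hcp, hvis⟩)
    · exact mem_union_right _ (mem_filter.2 ⟨hcp, hvis⟩)

/-- Two events at FUTURE vertices booking to the same chord are equal. [folklore] -/
theorem bookR_inj_after {τ : ℕ} {γ : Fin n → Fin d × Bool} {th th' : ℕ × ℕ}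
    (h : th ∈ onEventsR τ γ) (h' : th' ∈ onEventsR τ γ) (ha : ¬ th.2 < th.1) (ha' : ¬ th'.2 < th'.1)
    (heq : bookR γ th = bookR γ th') : th = th' := by
  obtain ⟨-, -, hne, hne1, -, hadjT, i, hit, hir, hadji⟩ := mem_onEventsR.1 h
  obtain ⟨-, -, hne', hne1', -, hadjT', i', hit', hir', hadji'⟩ := mem_onEventsR.1 h'
  rw [bookR, if_neg ha, bookR, if_neg ha'] at heq
  obtain ⟨hp, hh⟩ := Prod.mk.inj heq
  have hgt : th.1 + 1 < th.2 := by omega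
  have hgt' : th'.1 + 1 < th'.2 := by omega
  have hi1 : i + 1 ≤ th.1 := hir.1
  have hi1' : i' + 1 ≤ th'.1 := hir'.1
  suffices th.1 = th'.1 from Prod.ext this hh
  by_contra hne0
  rcases Nat.lt_or_gt_of_ne hne0 with hlt | hlt
  · -- `t < t'`: `prevInc (t+1) h < t + 1 ≤ prevInc (t'+1) h`
    obtain ⟨-, hpT, -, -⟩ := prevInc_spec γ (T := th.1 + 1) (h := th.2) (i := i) (by omega) (by omega) hadji
    have hcand := (prevInc_spec γ (T := th'.1 + 1) (h := th'.2) (i := th.1 + 1) (by omega)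
      (by omega) (by rw [← hh]; exact hadjT.symm)).1
    omega
  · obtain ⟨-, hpT, -, -⟩ := prevInc_spec γ (T := th'.1 + 1) (h := th'.2) (i := i') (by omega) (by omega) hadji'
    have hcand := (prevInc_spec γ (T := th.1 + 1) (h := th.2) (i := th'.1 + 1) (by omega)
      (by omega) (by rw [hh]; exact hadjT'.symm)).1
    omega

/-- Two events at FORGOTTEN vertices booking to the same chord are equal. [folklore] -/
theorem bookR_inj_before {γ : Fin n → Fin d × Bool} {th th' : ℕ × ℕ} (hb : th.2 < th.1) (hb' : th'.2 < th'.1)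
    (heq : bookR γ th = bookR γ th') : th = th' := by
  rw [bookR, if_pos hb, bookR, if_pos hb'] at heq
  obtain ⟨h1, h2⟩ := Prod.mk.inj heq
  exact Prod.ext (by omega) h1

/-- **Fibres of the booking map**: at most one event of each kind per chord, and no event at a forgotten vertex on
a detected chord. [folklore] -/
theorem card_fiber_bookR_le {τ : ℕ} {γ : Fin n → Fin d × Bool} (c : ℕ × ℕ) :
    ((onEventsR τ γ).filter fun th => bookR γ th = c).card ≤ if c ∈ invChordsR τ γ then 2 else 1 := by
  classical
  have hsplit := Finset.card_filter_add_card_filter_not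
    (s := (onEventsR τ γ).filter fun th => bookR γ th = c) (fun th : ℕ × ℕ => th.2 < th.1)
  have hFa1 : (((onEventsR τ γ).filter fun th => bookR γ th = c).filter
      fun th : ℕ × ℕ => ¬ th.2 < th.1).card ≤ 1 := by
    refine card_le_one.2 fun th hth th' hth' => ?_
    obtain ⟨hth, ha⟩ := mem_filter.1 hth
    obtain ⟨hth', ha'⟩ := mem_filter.1 hth'
    obtain ⟨h1, h2⟩ := mem_filter.1 hth
    obtain ⟨h1', h2'⟩ := mem_filter.1 hth'
    exact bookR_inj_after h1 h1' ha ha' (h2.trans h2'.symm)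
  have hFb1 : (((onEventsR τ γ).filter fun th => bookR γ th = c).filter
      fun th : ℕ × ℕ => th.2 < th.1).card ≤ 1 := by
    refine card_le_one.2 fun th hth th' hth' => ?_
    obtain ⟨hth, hb⟩ := mem_filter.1 hth
    obtain ⟨hth', hb'⟩ := mem_filter.1 hth'
    exact bookR_inj_before hb hb' ((mem_filter.1 hth).2.trans (mem_filter.1 hth').2.symm)
  by_cases hc : c ∈ invChordsR τ γ
  · rw [if_pos hc]; omega
  · rw [if_neg hc]
    have hFb0 : (((onEventsR τ γ).filter fun th => bookR γ th = c).filter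
        fun th : ℕ × ℕ => th.2 < th.1).card = 0 := by
      rw [card_eq_zero, filter_eq_empty_iff]
      intro th hth hb
      obtain ⟨h1, h2⟩ := mem_filter.1 hth
      exact hc (h2 ▸ (bookR_mem h1).2 hb)
    omega

/-- **The booking inequality for remembered visibility**:
`#on-path events ≤ #detected chords + 2 · #undetected chords`. [folklore] -/
theorem card_onEventsR_le (τ : ℕ) (γ : Fin n → Fin d × Bool) :
    (onEventsR τ γ).card ≤ (visChordsR τ γ).card + 2 * (invChordsR τ γ).card := by
  classical
  have hmaps : ∀ th ∈ onEventsR τ γ, bookR γ th ∈ visChordsR τ γ ∪ invChordsR τ γ := fun th h => (bookR_mem h).1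
  rw [card_eq_sum_card_fiberwise hmaps]
  have hdisj := disjoint_visChordsR_invChordsR τ γ
  rw [sum_union hdisj]
  have h1 : ∑ c ∈ visChordsR τ γ, ((onEventsR τ γ).filter fun th => bookR γ th = c).card ≤
      ∑ _c ∈ visChordsR τ γ, 1 := by
    refine sum_le_sum fun c hc => (card_fiber_bookR_le c).trans ?_
    rw [if_neg (disjoint_left.1 hdisj hc)]
  have h2 : ∑ c ∈ invChordsR τ γ, ((onEventsR τ γ).filter fun th => bookR γ th = c).card ≤
      ∑ _c ∈ invChordsR τ γ, 2 := by
    refine sum_le_sum fun c hc => (card_fiber_bookR_le c).trans ?_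
    rw [if_pos hc]
  rw [sum_const, smul_eq_mul, mul_one] at h1
  rw [sum_const, smul_eq_mul] at h2
  omega

/-! ### The detected chords, time by time -/

open Classical in
/-- The number of REMEMBERED chord partners of the new vertex `v_{t+1}`: indices `i < t` remembered at time `t` with
`v_i ~ v_{t+1}`. [folklore] -/
def remChordTrue (τ : ℕ) (γ : Fin n → Fin d × Bool) (t : ℕ) : ℕ :=
  ((range t).filter fun i => IsRem τ γ i t ∧ (zdGraph d).Adj (wordPos γ i) (wordPos γ (t + 1))).card

/-- The remembered chord count at time `t < n` is the number of detected chords with upper endpoint `t + 1`.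
[folklore] -/
theorem remChordTrue_eq_card {τ : ℕ} (γ : Fin n → Fin d × Bool) {t : ℕ} (ht : t < n) :
    remChordTrue τ γ t = ((visChordsR τ γ).filter fun ij => ij.2 = t + 1).card := by
  classical
  unfold remChordTrue
  refine card_nbij (fun i => (i, t + 1)) (fun i hi => ?_) (fun i₁ _ i₂ _ h => (Prod.mk.inj h).1) (fun ij hij => ?_)
  · rw [mem_coe, mem_filter, mem_range] at hi
    obtain ⟨hit, hir, hadj⟩ := hi
    rw [mem_coe, mem_filter, visChordsR, mem_filter, mem_chordPairs]
    refine ⟨⟨⟨by simp only; omega, by simp only; omega, hadj⟩, ?_⟩, rfl⟩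
    simp only [Nat.add_sub_cancel]
    exact hir
  · rw [mem_coe, mem_filter, visChordsR, mem_filter, mem_chordPairs] at hij
    obtain ⟨⟨⟨h1, h2, hadj⟩, hir⟩, h5⟩ := hij
    rw [h5, Nat.add_sub_cancel] at hir
    refine ⟨ij.1, ?_, ?_⟩
    · rw [mem_coe, mem_filter, mem_range]
      refine ⟨by omega, hir, ?_⟩
      rw [← h5]; exact hadj
    · exact Prod.ext rfl h5.symm

/-- **The remembered chord counts add up to the number of detected chords.** [folklore] -/
theorem sum_remChordTrue_eq (τ : ℕ) (γ : Fin n → Fin d × Bool) :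
    ∑ t ∈ range n, remChordTrue τ γ t = (visChordsR τ γ).card := by
  classical
  rw [card_eq_sum_card_fiberwise (f := fun ij : ℕ × ℕ => ij.2 - 1) (t := range n) (fun ij hij => ?_)]
  · refine sum_congr rfl fun t ht => ?_
    rw [remChordTrue_eq_card γ (mem_range.1 ht)]
    congr 1
    ext ij
    simp only [mem_filter, and_congr_right_iff]
    intro hij
    have := (mem_chordPairs.1 (mem_filter.1 hij).1).1
    omega
  · have h1 := (mem_chordPairs.1 (mem_filter.1 hij).1).1
    have h2 := (mem_chordPairs.1 (mem_filter.1 hij).1).2.1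
    rw [mem_coe, mem_range]
    show ij.2 - 1 < n
    omega

end Summit.CriticalPhenomena.PercolationContinuityZ3.Theorems.Pcint
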